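import Summits.ValiantsHypothesis.ValiantsHypothesis.Theorems.ProjectionStabilityUniqStepSymmetryReduction
import Summits.ValiantsHypothesis.ValiantsHypothesis.Theorems.ProjectionRigidityProjOptimalUniqueRefutation
import Literature.Computability.AlgebraicComplexity.GrenetProjection

/-!
# Crux `UniqStep` (stmt-ValiantsHypothesis-17834), line `Sketch` — NEGATIVE at level 3:
# an optimal projection of `per₃` that does NOT respect the left monomial symmetries

WHAT. (1) `not_uniqBase`: the finite base `ProjectionStability.UniqBase` of the route (= uniqueness of
optimal projections of `per₃`, item stmt-ValiantsHypothesis-17836) is FALSE — it is literally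
`ProjectionRigidity.ProjOptimalUniqueThree` once `pdc(per₃) = 7` (`detProjectionComplexity_perPoly_three`)
is substituted, and that was refuted in the tree by the purified single-syzygy Koszul twist of Grenet₃
(`not_ProjOptimalUniqueThree`).  (2) `not_halfEq_three`: hence, by the symmetry reduction of this line
(`halfEq_iff_uniq` at `N = 3`, `Opt 3` holds), NOT every optimal projection of `per₃` is half-symmetric:
(3) `exists_optimal_not_leftEquivariant_three`: there is an honest `7 × 7` projection `D` of `DET₇` with
`det D = per₃` such that neither `D` nor its variable-transpose `D.map (rename Prod.swap)` is an
exactly-lifted `leftMonomialSubst ℂ 3`-equivariant representation of `per₃` — a NEGATIVE answer, in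
Valiant's projection model at the optimal size `(3, 7)`, to Landsberg–Ressayre's Question 2.2 ("when an
object has symmetry, does it admit an optimal expression preserving it?" — here: not every optimal
expression preserves even half of it).

WHY (for the crux). `UniqStep` at `n = 3` and the line's bet `stub_symForced` at `n = 3` are now
VACUOUS (their antecedent `Uniq 3 = UniqBase` is false); the symmetry-propagation form of the step
(`uniqStep_iff_halfEq_step`) fails one level EARLIER than the crux's range: `Opt 2 ∧ HalfEq 2 ∧ Opt 3`
hold (disprover, `Cruxes/UniqStep/Disproof.lean`: both level-2 orbits are left-equivariant) while
`HalfEq 3` fails.  What remains of the crux is `∀ n ≥ 4, Opt n → Uniq n → Opt (n+1) → Uniq (n+1)`,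
and it is TRUE VACUOUSLY at every level `n ≥ 4` at which a second orbit of size `2ⁿ − 1` exists (the
source twist `Grenet_n · (1 + X(1,0) E_{{0},{1,2}} − X(0,0) E_{{1},{1,2}})` is an inequivalent AFFINE
representation at every `n ≥ 4` by the coefficient-rank multiset; its purifiability is the open point).

SOURCE. Landsberg–Ressayre 2017 (arXiv:1508.05788) Question 2.2, Thm. 2.8; Hüttenhain–Ikenmeyer 2016 §4.
No `sorry`, no named facts, no new definitions.
-/

-- D-0017 layout: Sub = Summit for this single-conjunct summit, so the namespace repeats a component.
set_option linter.dupNamespace false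

namespace Summit.ValiantsHypothesis.ValiantsHypothesis.Theorems.UniqStep.Negative

open MvPolynomial
open scoped BigOperators Matrix
open Literature.Computability.AlgebraicComplexity
open Summit.ValiantsHypothesis.ValiantsHypothesis.Theses.ProjectionStability (UniqBase)
open Summit.ValiantsHypothesis.ValiantsHypothesis.Theses.ProjectionRigidity (ProjOptimalUniqueThree)

noncomputable section

/-- **The finite base of route `ProjectionStability` is false**: `UniqBase` (uniqueness of optimal
projections of `per₃` modulo gauge × `permSymmetrySubst` × transpose) is `ProjOptimalUniqueThree` after
substituting `pdc(per₃) = 7`, refuted in the tree by Grenet₃ versus its purified Koszul twist.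
[folklore] -/
theorem not_uniqBase : ¬ UniqBase := by
  intro h
  refine not_ProjOptimalUniqueThree ?_
  have h' : ∀ A B : Matrix (Fin (detProjectionComplexity (perPoly (Fin 3) ℂ)))
      (Fin (detProjectionComplexity (perPoly (Fin 3) ℂ))) (MvPolynomial (Fin 3 × Fin 3) ℂ),
      (∀ i j, (∃ v, A i j = MvPolynomial.X v) ∨ ∃ c, A i j = MvPolynomial.C c) →
      (∀ i j, (∃ v, B i j = MvPolynomial.X v) ∨ ∃ c, B i j = MvPolynomial.C c) →
      A.det = perPoly (Fin 3) ℂ → B.det = perPoly (Fin 3) ℂ →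
      ∃ (P Q : GL (Fin (detProjectionComplexity (perPoly (Fin 3) ℂ))) ℂ) (γ : GL (Fin 3 × Fin 3) ℂ),
        γ ∈ permSymmetrySubst ℂ 3 ∧
        (B = (P : Matrix _ _ ℂ).map MvPolynomial.C * Matrix.linSubstEntries γ A * (Q : Matrix _ _ ℂ).map MvPolynomial.C ∨
          B = (P : Matrix _ _ ℂ).map MvPolynomial.C * (Matrix.linSubstEntries γ A).transpose *
            (Q : Matrix _ _ ℂ).map MvPolynomial.C) := h
  rw [detProjectionComplexity_perPoly_three] at h'
  exact h'

/-- `Opt 3`: Grenet is optimal at level 3 (`pdc(per₃) = 7`). [cite: AlperBogartVelasco2017, Cor. 1.4] -/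
theorem opt_three : 2 ^ 3 - 1 ≤ detProjectionComplexity (perPoly (Fin 3) ℂ) := by
  rw [detProjectionComplexity_perPoly_three]; norm_num

/-- **Not every optimal projection of `per₃` is half-symmetric**: the statement "every honest optimal
projection `D` of `per₃` is `leftMonomialSubst ℂ 3`-equivariant, or its variable-transpose is" is FALSE
(symmetry reduction `halfEq_iff_uniq` at `N = 3` + `not_uniqBase`). [cite: LandsbergRessayre2017, Question 2.2] -/
theorem not_halfEq_three :
    ¬ ∀ D : Matrix (Fin (detProjectionComplexity (perPoly (Fin 3) ℂ)))
        (Fin (detProjectionComplexity (perPoly (Fin 3) ℂ))) (MvPolynomial (Fin 3 × Fin 3) ℂ),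
      (∀ i j, (∃ v, D i j = X v) ∨ ∃ c, D i j = C c) → D.det = perPoly (Fin 3) ℂ →
      IsEquivariantDetRepr (leftMonomialSubst ℂ 3) (perPoly (Fin 3) ℂ) D ∨
        IsEquivariantDetRepr (leftMonomialSubst ℂ 3) (perPoly (Fin 3) ℂ)
          (D.map (rename (Prod.swap : Fin 3 × Fin 3 → Fin 3 × Fin 3))) := fun h =>
  not_uniqBase ((ProjectionStabilityUniqStep.halfEq_iff_uniq le_rfl opt_three).1 h)

/-- **An optimal expression of `per₃` breaking half the symmetry** (negative answer to LR17 Question 2.2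
in the projection model at `(3, 7)`): some honest `7 × 7` projection `D` of `DET₇` with `det D = per₃`
admits NO exact lifts of the left monomial symmetries, and neither does its variable-transpose.
[cite: LandsbergRessayre2017, Question 2.2] -/
theorem exists_optimal_not_leftEquivariant_three :
    ∃ D : Matrix (Fin 7) (Fin 7) (MvPolynomial (Fin 3 × Fin 3) ℂ),
      (∀ i j, (∃ v, D i j = X v) ∨ ∃ c, D i j = C c) ∧ D.det = perPoly (Fin 3) ℂ ∧
      ¬ IsEquivariantDetRepr (leftMonomialSubst ℂ 3) (perPoly (Fin 3) ℂ) D ∧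
      ¬ IsEquivariantDetRepr (leftMonomialSubst ℂ 3) (perPoly (Fin 3) ℂ)
          (D.map (rename (Prod.swap : Fin 3 × Fin 3 → Fin 3 × Fin 3))) := by
  have h := not_halfEq_three
  rw [detProjectionComplexity_perPoly_three] at h
  push Not at h
  obtain ⟨D, hD, hdet, h1, h2⟩ := h
  exact ⟨D, hD, hdet, h1, h2⟩

end

end Summit.ValiantsHypothesis.ValiantsHypothesis.Theorems.UniqStep.Negative
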